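import Mathlib
import Summits.Ventures.PercRepro.TriangleCapRegularCellGapTwo

/-!
# PercRepro — THE REGULAR CELL `t = 4 D` ON `5 + (s − t)` VERTICES, EXACTLY: `{bottom} ∪ [bottom + 3, bottom + 6 D]`
(p3, gen 54; part 292)

At `ℓ = 4` the row excess `Σ_{rows} k (4 − k)` is `0`, `6` or at least `8` (parts 290–291), and at most `12 D`
(`k (4 − k) ≤ 3 k`); conversely every even excess `2 m`, `3 ≤ m ≤ 6 D`, is realised by BLOCKS of four edges —
`(1,1,1,1)` (excess `6`), `(1,3)` (`3`), `(2,2)` (`4`), `(1,1,2)` (`5`), `(1,3,2,2)` (`7`), `(2,2,2,2)` (`8`) — with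
`m = 6 a + e`, `a = ⌊(m − 3)/6⌋`, `e ∈ [3, 8]`: `a` blocks `(1,1,1,1)`, the block(s) of `e`, and full rows `(4)` for
the rest (`rows_of_excess`, on lists).  THEOREM (`regular_cell_four`, `4 ≤ D`, `t = 4 D`, `2 t ≤ s`): `j` is the
band value of a triangle-free graph on `5 + (s − t)` vertices with `s` edges, a vertex of degree `s − t` and every
off-degree `≤ D` IFF `j = bottomReg 4 D` or `bottomReg 4 D + 3 ≤ j ≤ bottomReg 4 D + 6 D`
(`bottomReg 4 D = 6 D (D − 1)`; the census of §10dm: `K_{4,4}` at `72`, then `75, …, 96`).  Axioms: standard.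
-/

namespace PercRepro

namespace TriangleCap

namespace C047

open Finset

/-- A range sum of a function of the entries of a list is the sum over the list. -/
theorem sum_range_getD (L : List ℕ) (f : ℕ → ℕ) :
    ∑ i ∈ range L.length, f (L.getD i 0) = (L.map f).sum := by
  induction L with
  | nil => simp
  | cons x xs ih =>
    rw [List.length_cons, sum_range_succ', List.map_cons, List.sum_cons, add_comm]
    simp only [List.getD_cons_succ, List.getD_cons_zero]
    rw [ih]

/-- The entries of a list in `[1, 4]` give a sequence in `[1, 4]` below the length. -/
theorem getD_bounds (L : List ℕ) (hL : ∀ x ∈ L, 1 ≤ x ∧ x ≤ 4) (i : ℕ) (hi : i < L.length) :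
    1 ≤ L.getD i 0 ∧ L.getD i 0 ≤ 4 := by
  rw [List.getD_eq_getElem L 0 hi]
  exact hL _ (List.getElem_mem hi)

/-- The block of excess `e ∈ [3, 8]` (one or two rows of four edges each): its sizes. -/
def blockFour (e : ℕ) : List ℕ :=
  if e = 3 then [1, 3] else if e = 4 then [2, 2] else if e = 5 then [1, 1, 2] else if e = 6 then [1, 1, 1, 1]
  else if e = 7 then [1, 3, 2, 2] else [2, 2, 2, 2]

/-- The facts about a block: its entries lie in `[1, 4]`, its sum (its number of edges) is `4` or `8` (`4` for
`e ≤ 6`), and its excess is `2 e`. -/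
theorem blockFour_facts (e : ℕ) (he1 : 3 ≤ e) (he2 : e ≤ 8) :
    (∀ x ∈ blockFour e, 1 ≤ x ∧ x ≤ 4) ∧ ((blockFour e).sum = 4 ∨ (blockFour e).sum = 8) ∧
      (e ≤ 6 → (blockFour e).sum = 4) ∧ ((blockFour e).map (fun k => k * (4 - k))).sum = 2 * e := by
  unfold blockFour
  interval_cases e <;> simp

/-- **THE ROWS OF EVERY EXCESS:** for `3 ≤ m ≤ 6 D` there are row sizes `1 ≤ k i ≤ 4`, `i < N`, with `Σ k = 4 D`
and `Σ k (4 − k) = 2 m` (`a = ⌊(m − 3)/6⌋` blocks `(1,1,1,1)`, the block of `e = m − 6 a`, and full rows). -/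
theorem rows_of_excess (D m : ℕ) (hm1 : 3 ≤ m) (hm2 : m ≤ 6 * D) :
    ∃ (N : ℕ) (k : ℕ → ℕ), (∀ i, i < N → 1 ≤ k i ∧ k i ≤ 4) ∧ ∑ i ∈ range N, k i = 4 * D ∧
      ∑ i ∈ range N, k i * (4 - k i) = 2 * m := by
  set a := (m - 3) / 6 with ha
  set e := m - 6 * a with he
  have he1 : 3 ≤ e := by omega
  have he2 : e ≤ 8 := by omega
  have haD : a + 1 ≤ D := by omega
  have haD2 : 7 ≤ e → a + 2 ≤ D := by omega
  obtain ⟨hb1, hb2, hb3, hb5⟩ := blockFour_facts e he1 he2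
  set B := blockFour e with hB
  set c := B.sum / 4 with hc
  have hc' : B.sum = 4 * c := by
    rcases hb2 with h | h <;> rw [h] at hc ⊢ <;> omega
  have hcD : a + c ≤ D := by
    rcases hb2 with h | h
    · rw [h] at hc
      omega
    · rw [h] at hc
      have : 7 ≤ e := by
        by_contra hcon
        have := hb3 (by omega)
        omega
      have := haD2 this
      omega
  set L := List.replicate (4 * a) 1 ++ B ++ List.replicate (D - a - c) 4 with hL
  have hLmem : ∀ x ∈ L, 1 ≤ x ∧ x ≤ 4 := by
    intro x hx
    rw [hL, List.mem_append, List.mem_append, List.mem_replicate, List.mem_replicate] at hx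
    rcases hx with (hx | hx) | hx
    · omega
    · exact hb1 x hx
    · omega
  refine ⟨L.length, fun i => L.getD i 0, fun i hi => getD_bounds L hLmem i hi, ?_, ?_⟩
  · rw [sum_range_getD L (fun x => x), hL, List.map_append, List.map_append, List.sum_append, List.sum_append,
      List.map_id', List.map_id', List.map_id', List.sum_replicate, List.sum_replicate, hc']
    simp only [smul_eq_mul]
    omega
  · rw [sum_range_getD L (fun k => k * (4 - k)), hL, List.map_append, List.map_append, List.sum_append,
      List.sum_append, List.map_replicate, List.map_replicate, List.sum_replicate, List.sum_replicate, hb5]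
    simp only [smul_eq_mul]
    omega

/-- The excess of a row is at most three times its size: `k (4 − k) ≤ 3 k`. -/
theorem excess_le_three_mul (k : ℕ) : k * (4 - k) ≤ 3 * k := by
  rcases Nat.lt_or_ge k 4 with h | h
  · interval_cases k <;> omega
  · rw [Nat.sub_eq_zero_of_le h, mul_zero]
    exact Nat.zero_le _

/-- **THE REGULAR CELL `t = 4 D`, EXACTLY:** for `4 ≤ D`, `t = 4 D`, `2 t ≤ s`, `j` is the band value of a
triangle-free graph on `5 + (s − t)` vertices with `s` edges, a vertex of degree `s − t` and every off-degree
`≤ D` IFF `j = bottomReg 4 D` or `bottomReg 4 D + 3 ≤ j ≤ bottomReg 4 D + 6 D`. -/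
theorem regular_cell_four (s t D j : ℕ) (hD : 4 ≤ D) (ht : t = 4 * D) (hs : 2 * t ≤ s) :
    (∃ (H : SimpleGraph (Fin (4 + 1 + (s - t)))) (_ : DecidableRel H.Adj), H.CliqueFree 3 ∧
      H.edgeFinset.card = s ∧ ∃ w, deg H w + t = s ∧ (∀ v, offDeg H w v ≤ D) ∧
        ∑ v, deg H v * deg H v + 2 * (t * (s - t - 1)) + 2 * j = s * (s + 1)) ↔
    (j = bottomReg 4 D ∨ (bottomReg 4 D + 3 ≤ j ∧ j ≤ bottomReg 4 D + 6 * D)) := by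
  subst ht
  have hb := two_mul_bottomReg 4 D (by norm_num) hD
  constructor
  · intro hj
    obtain ⟨N, k, hk, hsum, hid⟩ := (regular_cell_iff s (4 * D) 4 D j (by norm_num) hD rfl hs).mp hj
    have hup : ∑ i ∈ range N, k i * (4 - k i) ≤ 12 * D := by
      calc ∑ i ∈ range N, k i * (4 - k i) ≤ ∑ i ∈ range N, 3 * k i := sum_le_sum (fun i _ => excess_le_three_mul (k i))
        _ = 3 * ∑ i ∈ range N, k i := by rw [mul_sum]
        _ = 12 * D := by rw [hsum]; ring
    rcases row_excess_trichotomy 4 D k N le_rfl (fun m hm => (hk m hm).1) (fun m hm => (hk m hm).2) hsum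
      with h0 | h1 | h2
    · left
      omega
    · right
      omega
    · right
      omega
  · rintro (rfl | ⟨hlo, hhi⟩)
    · exact ((regular_cell_first_gap s (4 * D) 4 D (by norm_num) hD rfl hs).2.1)
    · apply (regular_cell_iff s (4 * D) 4 D j (by norm_num) hD rfl hs).mpr
      obtain ⟨N, k, hk, hsum, hex⟩ := rows_of_excess D (j - bottomReg 4 D) (by omega) (by omega)
      refine ⟨N, k, hk, hsum, ?_⟩
      rw [hex]
      omega

end C047

end TriangleCap

end PercRepro
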